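import Literature.NumberTheory.Automorphic.AdelePlacesIdempotent
import Literature.NumberTheory.Automorphic.QuaternionAlgebraAdelicProofs
import Literature.NumberTheory.Automorphic.AdicCompletionCompact
import Literature.NumberTheory.Automorphic.AdelicSecondCountable
import Mathlib.Topology.Algebra.Ring.Ideal
import Mathlib.RingTheory.Ideal.Quotient.Operations
import Mathlib.LinearAlgebra.Quotient.Basic
import HarnessLib

/-!
# The ring `𝔸_K^S` of adeles away from a finite set `S` of finite places, as the quotient `𝔸_K ⧸ e_S 𝔸_K`

Topic `NumberTheory/Automorphic`; definitions with bodies (`adeleAwayIdeal`, `AdeleAway`,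
`AdeleAway.mk`, `AdeleAway.lift`) and theorems; no named fact. Instances are declared only on the
new type `AdeleAway K S`.

For a finite set `S` of finite places of a number field `K` the adele ring splits as
`𝔸_K = K_S × 𝔸_K^S` along the idempotent `e_S` (`adelePlacesIdem`, `AdelePlacesIdempotent`):
`K_S = e_S 𝔸_K = Π_{v ∈ S} K_v` and `𝔸_K^S = (1 - e_S) 𝔸_K`, the adeles with component `0` at the places
of `S` — as a ring in its own right, the **restricted product of the `K_w`, `w ∉ S`, together with
`K_∞`** (Cassels–Fröhlich, Ch. II §14; Gelbart (1975), §10, p. 153: `G^S = {g ∈ G_𝔸 : g_v = 1, v ∈ S}`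
is `GL₂` of this ring). We realise it as the quotient ring

  `AdeleAway K S = 𝔸_K ⧸ (e_S)`

(Mathlib `Ideal.Quotient`, quotient topology), which avoids building a second restricted product, and
prove what the comparison of trace formulas needs:

* `AdeleAway.mk : 𝔸_K →ₐ[K] 𝔸_K^S` — the projection, a continuous open surjective `K`-algebra map;
  `AdeleAway.mk_eq_mk_iff` — `x ≡ y` iff `(1 - e_S) x = (1 - e_S) y` iff `x_∞ = y_∞` and `x_w = y_w`
  for all `w ∉ S` (`AdeleAway.mk_eq_mk_iff_components`);
* `AdeleAway.lift : 𝔸_K^S →ₗ[𝔸_K] 𝔸_K` — the section `x̄ ↦ (1 - e_S) x`, continuous, injective, with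
  `mk ∘ lift = id` and `lift ∘ mk = ((1 - e_S) ·)` — exactly the data of
  `Literature.Topology.Algebra.cornerUnitsContinuousEquivOfSection` (`IdempotentUnitsQuotient`), by
  which `GL_n(𝔸_K^S) ≅ {g ∈ GL_n(𝔸_K) : g_v = 1, v ∈ S}` and `(𝔸_K^S ⊗_K D)ˣ ≅ {x ∈ D_𝔸ˣ : x_v = 1, v ∈ S}`;
* `AdeleAway.t2Space`, `AdeleAway.locallyCompactSpace`, `AdeleAway.secondCountableTopology`,
  `AdeleAway.nontrivial`; `AdeleAway.isUnit_algebraMap` (`Kˣ → (𝔸_K^S)ˣ`); the generic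
  `continuousMulEquivOfSubgroupEq` (equal subgroups of a topological group are `≃ₜ*`).

Part of the inline (D-0026) decomposition of
`Literature.NumberTheory.Automorphic.strong_multiplicity_one_quaternionUnits` (Gelbart's
identification `G'^S = G^S` in the comparison (10.14) = (10.15)).

## References

* J. W. S. Cassels, A. Fröhlich (eds.), *Algebraic Number Theory* (1967), Ch. II §14
  [CasselsFrohlichANT1967].
* S. Gelbart, *Automorphic forms on adele groups*, Ann. of Math. Studies 83 (1975), §10, p. 153
  [Gelbart1975].
-/

noncomputable section

open NumberField IsDedekindDomain Topology

namespace Literature.NumberTheory.Automorphic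

variable (K : Type) [Field K] [NumberField K] (S : Finset (HeightOneSpectrum (𝓞 K)))

/-- The ideal `e_S 𝔸_K = K_S × {0}` of adeles supported on `S`. [folklore] -/
def adeleAwayIdeal : Ideal (AdeleRing (𝓞 K) K) := Ideal.span {adelePlacesIdem K S}

/-- **The ring `𝔸_K^S` of adeles away from `S`**, as the quotient `𝔸_K ⧸ e_S 𝔸_K` (a commutative
topological `K`-algebra; Cassels–Fröhlich II §14). [folklore] -/
abbrev AdeleAway : Type := AdeleRing (𝓞 K) K ⧸ adeleAwayIdeal K S

variable {K S} in
/-- `x ∈ e_S 𝔸_K` iff `e_S x = x`. [folklore] -/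
theorem mem_adeleAwayIdeal_iff {x : AdeleRing (𝓞 K) K} : x ∈ adeleAwayIdeal K S ↔ adelePlacesIdem K S * x = x := by
  rw [adeleAwayIdeal, Ideal.mem_span_singleton]
  constructor
  · rintro ⟨c, rfl⟩
    rw [← mul_assoc, (isIdempotentElem_adelePlacesIdem S).eq]
  · intro h
    exact ⟨x, h.symm⟩

namespace AdeleAway

/-- **The projection `𝔸_K →ₐ[K] 𝔸_K^S`.** [folklore] -/
def mk : AdeleRing (𝓞 K) K →ₐ[K] AdeleAway K S := Ideal.Quotient.mkₐ K (adeleAwayIdeal K S)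

/-- `mk` is the quotient map (definitional). [folklore] -/
theorem mk_apply (x : AdeleRing (𝓞 K) K) : mk K S x = Ideal.Quotient.mk (adeleAwayIdeal K S) x := rfl

/-- The projection is onto. [folklore] -/
theorem mk_surjective : Function.Surjective (mk K S) := Ideal.Quotient.mk_surjective

/-- The projection is an open quotient map. [folklore] -/
theorem isOpenQuotientMap_mk : IsOpenQuotientMap (mk K S) := QuotientRing.isOpenQuotientMap_mk _

/-- The projection is continuous. [folklore] -/
theorem continuous_mk : Continuous (mk K S) := (isOpenQuotientMap_mk K S).continuous

variable {K S}

/-- **`x ≡ y mod e_S` iff `(1 - e_S) x = (1 - e_S) y`.** [folklore] -/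
theorem mk_eq_mk_iff {x y : AdeleRing (𝓞 K) K} :
    mk K S x = mk K S y ↔ (1 - adelePlacesIdem K S) * x = (1 - adelePlacesIdem K S) * y := by
  rw [mk_apply, mk_apply, Ideal.Quotient.mk_eq_mk_iff_sub_mem, mem_adeleAwayIdeal_iff, mul_sub]
  constructor
  · intro h
    linear_combination (-1 : AdeleRing (𝓞 K) K) * h
  · intro h
    linear_combination (-1 : AdeleRing (𝓞 K) K) * h

/-- **`x ≡ y mod e_S` iff `x` and `y` have the same archimedean part and the same components at the
finite places outside `S`.** [folklore] -/
theorem mk_eq_mk_iff_components {x y : AdeleRing (𝓞 K) K} :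
    mk K S x = mk K S y ↔ x.1 = y.1 ∧ ∀ w ∉ S, AdelicGroupData.adeleEval K w x = AdelicGroupData.adeleEval K w y := by
  rw [mk_eq_mk_iff, one_sub_adelePlacesIdem_mul_eq_mul_iff]

/-- `mk (e_S x) = 0`. [folklore] -/
theorem mk_adelePlacesIdem_mul (x : AdeleRing (𝓞 K) K) : mk K S (adelePlacesIdem K S * x) = 0 := by
  rw [← map_zero (mk K S), mk_eq_mk_iff, ← mul_assoc, sub_mul, one_mul,
    (isIdempotentElem_adelePlacesIdem S).eq, sub_self, zero_mul, mul_zero]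

/-- `mk e_S = 0`. [folklore] -/
theorem mk_adelePlacesIdem : mk K S (adelePlacesIdem K S) = 0 := by
  rw [← mul_one (adelePlacesIdem K S), mk_adelePlacesIdem_mul]

/-- `mk ((1 - e_S) x) = mk x`. [folklore] -/
theorem mk_one_sub_adelePlacesIdem_mul (x : AdeleRing (𝓞 K) K) :
    mk K S ((1 - adelePlacesIdem K S) * x) = mk K S x := by
  rw [mk_eq_mk_iff, ← mul_assoc, (isIdempotentElem_adelePlacesIdem S).one_sub.eq]

variable (K S)

/-- **The section `𝔸_K^S → 𝔸_K`, `x̄ ↦ (1 - e_S) x`** (well defined: `(1 - e_S) e_S = 0`), an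
`𝔸_K`-linear map — the inclusion of the corner `(1 - e_S) 𝔸_K`. [folklore] -/
def lift : AdeleAway K S →ₗ[AdeleRing (𝓞 K) K] AdeleRing (𝓞 K) K :=
  (adeleAwayIdeal K S).liftQ (LinearMap.mul (AdeleRing (𝓞 K) K) (AdeleRing (𝓞 K) K) (1 - adelePlacesIdem K S)) (by
    rw [adeleAwayIdeal, Ideal.span_le, Set.singleton_subset_iff, SetLike.mem_coe, LinearMap.mem_ker]
    change (1 - adelePlacesIdem K S) * adelePlacesIdem K S = 0
    rw [sub_mul, one_mul, (isIdempotentElem_adelePlacesIdem S).eq, sub_self])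

variable {K S}

/-- `lift (mk x) = (1 - e_S) x`. [folklore] -/
@[simp]
theorem lift_mk (x : AdeleRing (𝓞 K) K) : lift K S (mk K S x) = (1 - adelePlacesIdem K S) * x :=
  Submodule.liftQ_apply _ _ x

/-- **`mk ∘ lift = id`.** [folklore] -/
@[simp]
theorem mk_lift (y : AdeleAway K S) : mk K S (lift K S y) = y := by
  obtain ⟨x, rfl⟩ := mk_surjective K S y
  rw [lift_mk, mk_one_sub_adelePlacesIdem_mul]

/-- The section is injective. [folklore] -/
theorem lift_injective : Function.Injective (lift K S) :=
  Function.LeftInverse.injective mk_lift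

/-- `e_S · lift y = 0`: the section takes values in the corner `(1 - e_S) 𝔸_K`. [folklore] -/
theorem adelePlacesIdem_mul_lift (y : AdeleAway K S) : adelePlacesIdem K S * lift K S y = 0 := by
  obtain ⟨x, rfl⟩ := mk_surjective K S y
  rw [lift_mk, ← mul_assoc, mul_sub, mul_one, (isIdempotentElem_adelePlacesIdem S).eq, sub_self, zero_mul]

/-- `(1 - e_S) · lift y = lift y`. [folklore] -/
theorem one_sub_adelePlacesIdem_mul_lift (y : AdeleAway K S) : (1 - adelePlacesIdem K S) * lift K S y = lift K S y := by
  rw [sub_mul, one_mul, adelePlacesIdem_mul_lift, sub_zero]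

/-- The section is multiplicative (it is the inclusion of the ring `(1 - e_S) 𝔸_K`). [folklore] -/
theorem lift_mul (y y' : AdeleAway K S) : lift K S (y * y') = lift K S y * lift K S y' := by
  obtain ⟨x, rfl⟩ := mk_surjective K S y
  obtain ⟨x', rfl⟩ := mk_surjective K S y'
  rw [← map_mul, lift_mk, lift_mk, lift_mk]
  have h := (isIdempotentElem_adelePlacesIdem (K := K) S).one_sub.eq
  calc (1 - adelePlacesIdem K S) * (x * x')
      = (1 - adelePlacesIdem K S) * (1 - adelePlacesIdem K S) * (x * x') := by rw [h]
    _ = (1 - adelePlacesIdem K S) * x * ((1 - adelePlacesIdem K S) * x') := by ring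

variable (K S)

/-- **The section is continuous** (quotient topology: `lift ∘ mk = ((1 - e_S) ·)` is). [folklore] -/
theorem continuous_lift : Continuous (lift K S) := by
  refine (isOpenQuotientMap_mk K S).isQuotientMap.continuous_iff.2 ?_
  have h : (lift K S : AdeleAway K S → AdeleRing (𝓞 K) K) ∘ mk K S = fun x => (1 - adelePlacesIdem K S) * x :=
    funext fun x => lift_mk x
  rw [h]
  exact continuous_const.mul continuous_id

/-- The section is an embedding (`mk` is a continuous left inverse). [folklore] -/
theorem isEmbedding_lift : IsEmbedding (lift K S) := by
  refine ⟨IsInducing.of_comp (continuous_lift K S) (continuous_mk K S) ?_, lift_injective⟩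
  have h : (mk K S : AdeleRing (𝓞 K) K → AdeleAway K S) ∘ lift K S = id := funext fun y => mk_lift y
  rw [h]
  exact IsInducing.id

/-- `𝔸_K^S` is Hausdorff. [folklore] -/
instance t2Space : T2Space (AdeleAway K S) := by
  haveI : T2Space (AdeleRing (𝓞 K) K) := t2Space_adeleRing K
  exact (isEmbedding_lift K S).t2Space

/-- `𝔸_K^S` is locally compact (an open quotient of the locally compact `𝔸_K`). [folklore] -/
instance locallyCompactSpace : LocallyCompactSpace (AdeleAway K S) := by
  haveI : LocallyCompactSpace (AdeleRing (𝓞 K) K) := locallyCompactSpace_adeleRing' K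
  exact (isOpenQuotientMap_mk K S).locallyCompactSpace

/-- `𝔸_K^S` is second countable. [folklore] -/
instance secondCountableTopology : SecondCountableTopology (AdeleAway K S) := by
  haveI := secondCountableTopology_adeleRing K
  exact (isEmbedding_lift K S).secondCountableTopology

/-- The archimedean part of `e_S` is `0`, so `e_S ≠ 1` and `𝔸_K^S` is not the zero ring. [folklore] -/
instance nontrivial : Nontrivial (AdeleAway K S) := by
  refine ⟨⟨0, 1, fun h => ?_⟩⟩
  rw [← map_zero (mk K S), ← map_one (mk K S), mk_eq_mk_iff, mul_zero, mul_one] at h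
  have h1 : (0 : AdeleRing (𝓞 K) K).1 = (1 : AdeleRing (𝓞 K) K).1 - (adelePlacesIdem K S).1 := congrArg Prod.fst h
  rw [adelePlacesIdem_fst, sub_zero] at h1
  exact one_ne_zero (α := InfiniteAdeleRing K) h1.symm

/-- Non-zero elements of `K` are units of `𝔸_K^S`. [folklore] -/
theorem isUnit_algebraMap {c : K} (hc : c ≠ 0) : IsUnit (algebraMap K (AdeleAway K S) c) :=
  (IsUnit.mk0 c hc).map (algebraMap K (AdeleAway K S))

/-- `algebraMap K 𝔸_K^S = mk ∘ algebraMap K 𝔸_K` (definitional). [folklore] -/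
theorem algebraMap_eq (c : K) : algebraMap K (AdeleAway K S) c = mk K S (algebraMap K (AdeleRing (𝓞 K) K) c) := rfl

end AdeleAway

/-- Equal subgroups of a topological group are isomorphic as topological groups (the identity map).
Used to
rewrite the sources `{g : g_v = 1, v ∈ S}` of the isomorphisms with units over `𝔸_K^S`. [folklore] -/
def continuousMulEquivOfSubgroupEq {G : Type*} [Group G] [TopologicalSpace G] {H₁ H₂ : Subgroup G} (h : H₁ = H₂) :
    H₁ ≃ₜ* H₂ :=
  { MulEquiv.subgroupCongr h with
    continuous_toFun := continuous_subtype_val.subtype_mk _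
    continuous_invFun := continuous_subtype_val.subtype_mk _ }

end Literature.NumberTheory.Automorphic
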